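import Mathlib.Algebra.CharP.Two
import Mathlib.Algebra.Module.ZMod
import Mathlib.Data.Matrix.Basis
import Mathlib.LinearAlgebra.Dual.Lemmas
import Summits.HodgeConjecture.CorCM.Census.TypeStabiliserUnbounded

/-!
# `𝒦(𝒰ₑ,c) = ker λ` is the involution subgroup of `𝒰ₑ`, and `d₂(𝒰ₑ/𝒦) = 2^e` exactly

COR-CM (cell `pub-hodgecm2`), count-neutral kernel combinatorics by the census seat lit-andre-3 (gen 35; lane
TYPE-STABILISER-UNBOUNDED, sequel of `Census/TypeStabiliserUnbounded.lean` (gen 24) and `Census/TypeStabiliserExact.lean` (gen 29)).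
Theorems only: no definition, no `Prop`-valued definition, no `decide`, no certificate, no named fact, no `sorry`.
HONEST FRAMING: `HC_CM` is NOT proved, here or anywhere in the tree; nothing here is a period or a headline.

THE QUESTION.  For the Frobenius‑unitriangular `2`-group `𝒰ₑ ≤ GL_{2^e+1}(k)`, `k = 𝔽_{2^{2^e}}` (`FrobUT.frobUT`), with its central
involution `c = 1 + E₀ₜ` and its character `λ : 𝒰ₑ ↠ (k,+)` (`FrobUT.lamHom`), `Census/TypeStabiliserUnbounded.lean` proved
`𝒦(𝒰ₑ,c) ≤ ker λ` (`stabGen_le_ker`, from the ROOT LAW `u^{2^e} = c` iff `λ(u) ≠ 0`) and hence the LOWER BOUND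
`d₂(𝒰ₑ/𝒦(𝒰ₑ,c)) ≥ 2^e` (`two_pow_le_indexTwoRank_stabGen`); `Census/TypeStabiliserExact.lean` computed `d₂` EXACTLY, but for the
SUBGROUPS `⟨c, g(w i)⟩ ≤ 𝒰ₑ`.  The exact value for the full group `𝒰ₑ` — equivalently: is `𝒦(𝒰ₑ,c)` ALL of `ker λ`? — was left open
(seat STATUS gen 29, OUTLOOK (c′)).  THIS FILE answers it: **`𝒦(𝒰ₑ,c) = ker λ = Ω(𝒰ₑ) := ⟨u ∈ 𝒰ₑ : u² = 1⟩`** (`stabGen_eq_ker`,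
`closure_involutions_eq_ker`, `stabGen_eq_closure_involutions`; `e ≠ 0`), so `𝒰ₑ/𝒦 ≅ (k,+)` is elementary abelian of order `2^{2^e}`
(`index_stabGen`) and **`d₂(𝒰ₑ/𝒦(𝒰ₑ,c)) = 2^e` EXACTLY** (`indexTwoRank_stabGen_eq_two_pow`; packaged `G`-agnostically as
`exists_indexTwoRank_stabGen_eq_two_pow`).  In words: the type-stabiliser subgroup of `𝒰ₑ` is cut out by the single linear condition
`u_{0,1} = 0` (`mem_stabGen_iff_lam_eq_zero`).

THE ARGUMENT.
* §1 The elementary matrices `1 + a·E_{ij}` with `j ≥ i + 2` (off the superdiagonal) lie in `𝒰ₑ` with `λ = 0` and are INVOLUTIONS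
  (`(a·E_{ij})² = 0`, characteristic `2`); every involution `u` of any group lies in `𝒦(G,c)` for `c ≠ 1` (`⟨u⟩ = {1,u}`,
  `Census/TypeStabiliserSubgroup.mem_stabGen_of_mul_self_eq_one`), so `Ω(𝒰ₑ) ≤ 𝒦(𝒰ₑ,c)` (`closure_involutions_le_stabGen`).
* §2 **`ker λ ≤ Ω(𝒰ₑ)`** (`ker_lamHom_le_closure_involutions`): `ker λ` is the pattern group of unitriangular matrices with ZERO
  superdiagonal, and it is generated by the elementary involutions of §1 — by induction on the number of non-zero off-diagonal entries
  of `u ∈ ker λ`: pick such an entry `(i,j)` with `j` MAXIMAL; then row `j` of `u` is the unit row, so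
  `(1 + u_{ij}E_{ij})·u = u + u_{ij}E_{ij}` differs from `u` exactly at `(i,j)`, where it vanishes (`u_{ij} + u_{ij} = 0`)
  (`mem_closure_involutions_of_lam_eq_zero`).
* §3 Hence `ker λ ≤ Ω ≤ 𝒦 ≤ ker λ` for `e ≠ 0`: all three coincide.  Counting, `𝒰ₑ/ker λ ≅ (k,+)` (`lamHom_surjective`) has exactly
  `#Hom((k,+), ℤ/2) = #Hom_𝔽₂(k, 𝔽₂) = 2^{dim_𝔽₂ k} = 2^{2^e}` sign characters (`card_addChar_Fq`, sharpening `card_le_card_addChar`), and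
  `#Hom(G/N, ℤ/2) = 2^{d₂(G/N)}` (`Census/TypeStabiliserIndexTwoRank.card_signChar_quotient`), so `d₂(𝒰ₑ/ker λ) = 2^e`
  (`indexTwoRank_ker_lamHom`) and `d₂(𝒰ₑ/𝒦) = 2^e`.
(For `e = 0` the matrices are `2 × 2`, `c = g(1)` has `λ(c) = 1` and `𝒦 = 𝒰₀ = ℤ/2 ≠ ker λ = 1`; the hypothesis `e ≠ 0` of §3 is needed.)
By memo g23 §1 (Neukirch–Schmidt–Wingberg (9.6.7)(i)) every such pair is `(Gal(F/ℚ), complex conjugation)` for a Galois CM field `F`;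
that sentence is the memoʼs, not this fileʼs.

## References
* [Pohlmann1968] H. Pohlmann, Algebraic cycles on abelian varieties of complex multiplication type, Ann. of Math. 88 (1968), Thm 1.
* [Milne1999] J. S. Milne, Lefschetz motives and the Tate conjecture, Compositio Math. 117 (1999), Prop. 2.1, p. 54.
-/

namespace Summit.HodgeConjecture.CorCM.Census.TypeStabiliser

open Summit.HodgeConjecture.CorCM.Census.IndexTwo

noncomputable section

namespace FrobUT

variable {e : ℕ}

/-! ## §1 Elementary involutions `1 + a·E_{ij}` (`j ≥ i + 2`) of `𝒰ₑ` -/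

/-- The element of `𝒰ₑ` with a given Frobenius‑unitriangular matrix has that matrix. [folklore] -/
theorem toMat_mk {M : Mat e} (hM : M ∈ good e) : toMat e ⟨goodUnit hM, hM⟩ = M := rfl

/-- Rebuilding an element of `𝒰ₑ` from its matrix gives it back. [folklore] -/
theorem mk_toMat (g : frobUT e) : (⟨goodUnit (toMat_mem_good e g), toMat_mem_good e g⟩ : frobUT e) = g :=
  toMat_injective e rfl

/-- A Frobenius‑unitriangular matrix without non-zero off-diagonal entries is the identity of `𝒰ₑ`. [folklore] -/
theorem mk_eq_one_of_forall {M : Mat e} (hM : M ∈ good e) (h : ∀ k l : Fin (2 ^ e + 1), k ≠ l → M k l = 0) :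
    (⟨goodUnit hM, hM⟩ : frobUT e) = 1 := by
  apply toMat_injective
  rw [toMat_one]
  ext k l
  change M k l = (1 : Mat e) k l
  by_cases hkl : k = l
  · subst hkl
    rw [Matrix.one_apply_eq, diag_of_mem hM]
  · rw [Matrix.one_apply_ne hkl, h k l hkl]

/-- `a·E_{ij} · M = a·E_{ij}` whenever row `j` of `M` is the `j`-th unit row. [folklore] -/
theorem single_mul_eq_self {i j : Fin (2 ^ e + 1)} (a : Fq e) {M : Mat e} (hjj : M j j = 1)
    (hrow : ∀ l, l ≠ j → M j l = 0) : Matrix.single i j a * M = Matrix.single i j a := by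
  ext k l
  by_cases hk : k = i
  · subst hk
    rw [Matrix.single_mul_apply_same]
    by_cases hl : l = j
    · subst hl
      rw [hjj, mul_one, Matrix.single_apply_same]
    · rw [hrow l hl, mul_zero, Matrix.single_apply_of_ne]
      exact fun h => hl h.2.symm
  · rw [Matrix.single_mul_apply_of_ne (h := hk), Matrix.single_apply_of_row_ne (Ne.symm hk)]

section Elementary

variable {i j : Fin (2 ^ e + 1)} (hij : (i : ℕ) + 2 ≤ (j : ℕ)) (a : Fq e)
include hij

/-- The superdiagonal of `1 + a·E_{ij}` vanishes (`j ≥ i + 2` is off the superdiagonal). [folklore] -/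
theorem sd_one_add_single (r : Fin (2 ^ e)) : sd e (1 + Matrix.single i j a) r = 0 := by
  rw [sd, Matrix.add_apply, Matrix.one_apply_ne (castSucc_ne_succ r), zero_add, Matrix.single_apply_of_ne]
  rintro ⟨h1, h2⟩
  have h1' : (i : ℕ) = r := by rw [h1, Fin.val_castSucc]
  have h2' : (j : ℕ) = r + 1 := by rw [h2, Fin.val_succ]
  omega

/-- `λ(1 + a·E_{ij}) = 0`. [folklore] -/
theorem lam_one_add_single : lam e (1 + Matrix.single i j a) = 0 := sd_one_add_single hij a _

/-- `1 + a·E_{ij}` (`j ≥ i + 2`) is Frobenius‑unitriangular, i.e. lies in `𝒰ₑ`. [folklore] -/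
theorem one_add_single_mem_good : 1 + Matrix.single i j a ∈ good e := by
  refine ⟨fun k => ?_, fun k l hkl => ?_, fun r => ?_⟩
  · rw [Matrix.add_apply, Matrix.one_apply_eq, Matrix.single_apply_of_ne, add_zero]
    rintro ⟨h1, h2⟩
    have := congrArg Fin.val (h1.trans h2.symm)
    omega
  · have hne : k ≠ l := fun h => by
      subst h
      exact lt_irrefl _ hkl
    rw [Matrix.add_apply, Matrix.one_apply_ne hne, Matrix.single_apply_of_ne, add_zero]
    rintro ⟨h1, h2⟩
    have h1' := congrArg Fin.val h1
    have h2' := congrArg Fin.val h2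
    omega
  · rw [sd_one_add_single hij a, lam_one_add_single hij a, zero_pow (pow_ne_zero _ two_ne_zero)]

/-- `(1 + a·E_{ij})² = 1`: `E_{ij}² = 0` for `i ≠ j` and `2 = 0` in `k`. [folklore] -/
theorem one_add_single_mul_self : (1 + Matrix.single i j a) * (1 + Matrix.single i j a) = 1 := by
  have hji : j ≠ i := fun h => by
    have := congrArg Fin.val h
    omega
  rw [add_mul, one_mul, mul_add, mul_one, Matrix.single_mul_single_of_ne (h := hji), add_zero, add_assoc,
    ← Matrix.single_add, CharTwo.add_self_eq_zero, Matrix.single_zero, add_zero]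

/-- **The elementary involution `1 + a·E_{ij} ∈ 𝒰ₑ`** (`j ≥ i + 2`) squares to `1`. [folklore] -/
theorem elem_mul_self :
    (⟨goodUnit (one_add_single_mem_good hij a), one_add_single_mem_good hij a⟩ : frobUT e) *
      ⟨goodUnit (one_add_single_mem_good hij a), one_add_single_mem_good hij a⟩ = 1 :=
  toMat_injective e (by rw [toMat_mul, toMat_one]; exact one_add_single_mul_self hij a)

end Elementary

variable (e) in
/-- **`Ω(𝒰ₑ) ≤ 𝒦(𝒰ₑ,c)`**: every involution lies in the type-stabiliser subgroup (`c ≠ 1`, `⟨u⟩ = {1,u}`). [folklore] -/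
theorem closure_involutions_le_stabGen : Subgroup.closure {g : frobUT e | g * g = 1} ≤ stabGen (c e) :=
  (Subgroup.closure_le _).mpr fun _ hg => mem_stabGen_of_mul_self_eq_one (c e) (c_ne_one e) hg

/-! ## §2 `ker λ` is generated by the elementary involutions -/

/-- A matrix of `𝒰ₑ` with `λ = 0` and NO non-zero off-diagonal entry gives an element of `Ω(𝒰ₑ)` (namely `1`). [folklore] -/
theorem mk_mem_closure_of_support_eq_empty {M : Mat e} (hM : M ∈ good e)
    (h : {p : Fin (2 ^ e + 1) × Fin (2 ^ e + 1) | p.1 ≠ p.2 ∧ M p.1 p.2 ≠ 0} = ∅) :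
    (⟨goodUnit hM, hM⟩ : frobUT e) ∈ Subgroup.closure {g : frobUT e | g * g = 1} := by
  have h1 : (⟨goodUnit hM, hM⟩ : frobUT e) = 1 := mk_eq_one_of_forall hM fun k l hkl => by
    by_contra h0
    have hmem : ((k, l) : Fin (2 ^ e + 1) × Fin (2 ^ e + 1)) ∈
        {p : Fin (2 ^ e + 1) × Fin (2 ^ e + 1) | p.1 ≠ p.2 ∧ M p.1 p.2 ≠ 0} := by
      simp only [Set.mem_setOf_eq]
      exact ⟨hkl, h0⟩
    rw [h] at hmem
    exact hmem
  rw [h1]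
  exact one_mem _

/-- **Every `u ∈ 𝒰ₑ` with `λ(u) = 0` is a product of elementary involutions** — induction on the number `n` of non-zero
off-diagonal entries of `u`: choose such an entry `(i,j)` with `j` maximal; then `j ≥ i+2` (the superdiagonal of `u` is
`λ(u)^{2^r} = 0`), row `j` of `u` is the unit row, and `(1 + u_{ij}E_{ij})·u = u + u_{ij}E_{ij}` has one non-zero off-diagonal entry
fewer. [folklore] -/
theorem mem_closure_involutions_of_lam_eq_zero (n : ℕ) : ∀ {M : Mat e} (hM : M ∈ good e), lam e M = 0 →
    {p : Fin (2 ^ e + 1) × Fin (2 ^ e + 1) | p.1 ≠ p.2 ∧ M p.1 p.2 ≠ 0}.ncard ≤ n →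
    (⟨goodUnit hM, hM⟩ : frobUT e) ∈ Subgroup.closure {g : frobUT e | g * g = 1} := by
  induction n with
  | zero =>
    intro M hM _ hS
    exact mk_mem_closure_of_support_eq_empty hM ((Set.ncard_eq_zero (Set.toFinite _)).mp (Nat.le_zero.mp hS))
  | succ n ih =>
    intro M hM hlam hS
    by_cases hempty : {p : Fin (2 ^ e + 1) × Fin (2 ^ e + 1) | p.1 ≠ p.2 ∧ M p.1 p.2 ≠ 0} = ∅
    · exact mk_mem_closure_of_support_eq_empty hM hempty
    -- a non-zero off-diagonal entry `(i,j)` with `j` maximal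
    obtain ⟨p, hp, hmax⟩ := Set.exists_max_image _ (fun p : Fin (2 ^ e + 1) × Fin (2 ^ e + 1) => (p.2 : ℕ))
      (Set.toFinite _) (Set.nonempty_iff_ne_empty.mpr hempty)
    obtain ⟨i, j⟩ := p
    simp only [Set.mem_setOf_eq] at hp
    obtain ⟨hij0, hMij⟩ := hp
    have hlt : (i : ℕ) < j := by
      rcases lt_trichotomy (i : ℕ) j with h | h | h
      · exact h
      · exact absurd (Fin.ext h) hij0
      · exact absurd (lower_of_mem hM h) hMij
    -- `(i,j)` is off the superdiagonal, since the superdiagonal of `M` is `λ(M)^{2^r} = 0`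
    have hij : (i : ℕ) + 2 ≤ j := by
      by_contra hcon
      have hj : (j : ℕ) = i + 1 := by omega
      have hi : (i : ℕ) < 2 ^ e := by
        have := j.2
        omega
      have hs := super_of_mem hM ⟨i, hi⟩
      rw [hlam, zero_pow (pow_ne_zero _ two_ne_zero), sd] at hs
      have h1 : (⟨i, hi⟩ : Fin (2 ^ e)).castSucc = i := Fin.ext rfl
      have h2 : (⟨i, hi⟩ : Fin (2 ^ e)).succ = j := Fin.ext (by rw [Fin.val_succ]; exact hj.symm)
      rw [h1, h2] at hs
      exact hMij hs
    -- row `j` of `M` is the unit row (maximality of `j`)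
    have hrow : ∀ l, l ≠ j → M j l = 0 := by
      intro l hl
      rcases Nat.lt_or_gt_of_ne (fun h : (l : ℕ) = j => hl (Fin.ext h)) with h | h
      · exact lower_of_mem hM h
      · by_contra hne0
        have hle : (l : ℕ) ≤ j := by
          simpa using hmax (j, l) (show j ≠ l ∧ M j l ≠ 0 from ⟨Ne.symm hl, hne0⟩)
        omega
    -- the elementary involution `E = 1 + M_{ij} E_{ij}` and the reduced matrix `E * M = M + M_{ij} E_{ij}`
    have hE := one_add_single_mem_good hij (M i j)
    have hEM : (1 + Matrix.single i j (M i j)) * M = M + Matrix.single i j (M i j) := by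
      rw [add_mul, one_mul, single_mul_eq_self (M i j) (diag_of_mem hM j) hrow]
    have hM' : (1 + Matrix.single i j (M i j)) * M ∈ good e := mul_mem_good hE hM
    have hlam' : lam e ((1 + Matrix.single i j (M i j)) * M) = 0 := by
      rw [lam_mul hE hM, lam_one_add_single hij, hlam, add_zero]
    -- its off-diagonal support lost `(i,j)` and nothing else changed
    have hsub : {p : Fin (2 ^ e + 1) × Fin (2 ^ e + 1) | p.1 ≠ p.2 ∧ ((1 + Matrix.single i j (M i j)) * M) p.1 p.2 ≠ 0} ⊆
        {p : Fin (2 ^ e + 1) × Fin (2 ^ e + 1) | p.1 ≠ p.2 ∧ M p.1 p.2 ≠ 0} \ {(i, j)} := by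
      rintro ⟨k, l⟩ hkl
      simp only [Set.mem_sdiff, Set.mem_singleton_iff, Set.mem_setOf_eq, Prod.mk.injEq] at hkl ⊢
      obtain ⟨hkl, hne0⟩ := hkl
      rw [hEM, Matrix.add_apply] at hne0
      by_cases hq : i = k ∧ j = l
      · obtain ⟨rfl, rfl⟩ := hq
        rw [Matrix.single_apply_same, CharTwo.add_self_eq_zero] at hne0
        exact absurd rfl hne0
      · rw [Matrix.single_apply_of_ne (h := hq), add_zero] at hne0
        exact ⟨⟨hkl, hne0⟩, fun h => hq ⟨h.1.symm, h.2.symm⟩⟩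
    have hcard : {p : Fin (2 ^ e + 1) × Fin (2 ^ e + 1) |
        p.1 ≠ p.2 ∧ ((1 + Matrix.single i j (M i j)) * M) p.1 p.2 ≠ 0}.ncard ≤ n := by
      have hmem : ((i, j) : Fin (2 ^ e + 1) × Fin (2 ^ e + 1)) ∈
          {p : Fin (2 ^ e + 1) × Fin (2 ^ e + 1) | p.1 ≠ p.2 ∧ M p.1 p.2 ≠ 0} := by
        simp only [Set.mem_setOf_eq]
        exact ⟨hij0, hMij⟩
      have h1 := Set.ncard_le_ncard hsub
      have h2 := Set.ncard_sdiff_singleton_lt_of_mem hmem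
      omega
    -- `M = E * (E * M)` with both factors in `Ω(𝒰ₑ)`
    have hmemE : (⟨goodUnit hE, hE⟩ : frobUT e) ∈ Subgroup.closure {g : frobUT e | g * g = 1} :=
      Subgroup.subset_closure (elem_mul_self hij (M i j))
    have hprod : (⟨goodUnit hM, hM⟩ : frobUT e) = ⟨goodUnit hE, hE⟩ * ⟨goodUnit hM', hM'⟩ := by
      apply toMat_injective
      rw [toMat_mul]
      change M = (1 + Matrix.single i j (M i j)) * ((1 + Matrix.single i j (M i j)) * M)
      rw [← mul_assoc, one_add_single_mul_self hij, one_mul]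
    rw [hprod]
    exact mul_mem hmemE (ih hM' hlam' hcard)

variable (e)

/-- **`ker λ ≤ Ω(𝒰ₑ)`**: every element of `𝒰ₑ` with `u_{0,1} = 0` is a product of involutions. [folklore] -/
theorem ker_lamHom_le_closure_involutions : (lamHom e).ker ≤ Subgroup.closure {g : frobUT e | g * g = 1} := by
  intro g hg
  rw [MonoidHom.mem_ker, lamHom_apply] at hg
  have hlam : lam e (toMat e g) = 0 := Multiplicative.ofAdd.injective (by rw [ofAdd_zero]; exact hg)
  have h := mem_closure_involutions_of_lam_eq_zero _ (toMat_mem_good e g) hlam le_rfl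
  rwa [mk_toMat] at h

/-- **`ker λ ≤ 𝒦(𝒰ₑ,c)`** (any `e`). [folklore] -/
theorem ker_lamHom_le_stabGen : (lamHom e).ker ≤ stabGen (c e) :=
  (ker_lamHom_le_closure_involutions e).trans (closure_involutions_le_stabGen e)

/-! ## §3 `𝒦(𝒰ₑ,c) = Ω(𝒰ₑ) = ker λ` and the exact `2`-rank `d₂(𝒰ₑ/𝒦) = 2^e` -/

/-- **`𝒦(𝒰ₑ,c) = ker λ`** (`e ≠ 0`): with `stabGen_le_ker` of `Census/TypeStabiliserUnbounded.lean`. [folklore] -/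
theorem stabGen_eq_ker (he : e ≠ 0) : stabGen (c e) = (lamHom e).ker :=
  le_antisymm (stabGen_le_ker e he) (ker_lamHom_le_stabGen e)

/-- **`Ω(𝒰ₑ) = ker λ`** (`e ≠ 0`): the involutions of `𝒰ₑ` generate exactly `ker λ`. [folklore] -/
theorem closure_involutions_eq_ker (he : e ≠ 0) : Subgroup.closure {g : frobUT e | g * g = 1} = (lamHom e).ker :=
  le_antisymm ((closure_involutions_le_stabGen e).trans (stabGen_le_ker e he)) (ker_lamHom_le_closure_involutions e)

/-- **`𝒦(𝒰ₑ,c) = Ω(𝒰ₑ)`** (`e ≠ 0`): the type-stabiliser subgroup of `𝒰ₑ` is its involution subgroup. [folklore] -/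
theorem stabGen_eq_closure_involutions (he : e ≠ 0) :
    stabGen (c e) = Subgroup.closure {g : frobUT e | g * g = 1} := by
  rw [stabGen_eq_ker e he, closure_involutions_eq_ker e he]

/-- Membership in `𝒦(𝒰ₑ,c)` is the single linear condition `u_{0,1} = 0` (`e ≠ 0`). [folklore] -/
theorem mem_stabGen_iff_lam_eq_zero (he : e ≠ 0) (g : frobUT e) : g ∈ stabGen (c e) ↔ lam e (toMat e g) = 0 := by
  rw [stabGen_eq_ker e he, MonoidHom.mem_ker, lamHom_apply]
  exact ⟨fun h => Multiplicative.ofAdd.injective (by rw [ofAdd_zero]; exact h), fun h => by rw [h, ofAdd_zero]⟩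

/-- **`#Hom((k,+), ℤ/2) = 2^{2^e}`** for `k = 𝔽_{2^{2^e}}`: additive characters are the `𝔽₂`-linear functionals, and
`dim_𝔽₂ Hom_𝔽₂(k, 𝔽₂) = dim_𝔽₂ k = 2^e` (sharpens `card_le_card_addChar`). [folklore] -/
theorem card_addChar_Fq : Nat.card (Multiplicative (Fq e) →* Multiplicative (ZMod 2)) = 2 ^ 2 ^ e := by
  have h1 : Nat.card (Multiplicative (Fq e) →* Multiplicative (ZMod 2)) = Nat.card (Fq e →+ ZMod 2) :=
    Nat.card_congr AddMonoidHom.toMultiplicative.symm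
  have h2 : Nat.card (Fq e →+ ZMod 2) = Nat.card (Fq e →ₗ[ZMod 2] ZMod 2) :=
    Nat.card_congr (AddMonoidHom.toZModLinearMapEquiv 2).toEquiv
  have h3 : Nat.card (Fq e →ₗ[ZMod 2] ZMod 2) = 2 ^ Module.finrank (ZMod 2) (Fq e →ₗ[ZMod 2] ZMod 2) := by
    rw [Module.natCard_eq_pow_finrank (K := ZMod 2), Nat.card_zmod]
  have h4 : Module.finrank (ZMod 2) (Fq e →ₗ[ZMod 2] ZMod 2) = 2 ^ e :=
    Subspace.dual_finrank_eq.trans (GaloisField.finrank 2 (pow_ne_zero e two_ne_zero))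
  rw [h1, h2, h3, h4]

/-- **`d₂(𝒰ₑ/ker λ) = 2^e`**: `𝒰ₑ/ker λ ≅ (k,+)` has `2^{2^e}` sign characters, and `#Hom(G/N, ℤ/2) = 2^{d₂(G/N)}`. [folklore] -/
theorem indexTwoRank_ker_lamHom : indexTwoRank (lamHom e).ker = 2 ^ e := by
  have h := card_signChar_quotient (lamHom e).ker
  rw [Nat.card_congr (MulEquiv.monoidHomCongrLeftEquiv (N := Multiplicative (ZMod 2))
      (QuotientGroup.quotientKerEquivOfSurjective (lamHom e) (lamHom_surjective e))), card_addChar_Fq] at h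
  exact (Nat.pow_right_injective (le_refl 2) h).symm

/-- **`[𝒰ₑ : 𝒦(𝒰ₑ,c)] = 2^{2^e}`** (`e ≠ 0`): `𝒰ₑ/𝒦 ≅ (k,+)` is elementary abelian of order `#k`. [folklore] -/
theorem index_stabGen (he : e ≠ 0) : (stabGen (c e)).index = 2 ^ 2 ^ e := by
  rw [stabGen_eq_ker e he, Subgroup.index_eq_card,
    Nat.card_congr (QuotientGroup.quotientKerEquivOfSurjective (lamHom e) (lamHom_surjective e)).toEquiv,
    Nat.card_congr Multiplicative.toAdd]
  exact card_Fq e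

/-- **THE EXACT VALUE: `d₂(𝒰ₑ/𝒦(𝒰ₑ,c)) = 2^e`** (`e ≠ 0`) — the lower bound `two_pow_le_indexTwoRank_stabGen` of
`Census/TypeStabiliserUnbounded.lean` is attained; by `Census/TypeStabiliserCharK` equivalently `dim_𝔽₂ 𝔛(𝒰ₑ,c) = 2^e`. [folklore] -/
theorem indexTwoRank_stabGen_eq_two_pow (he : e ≠ 0) : indexTwoRank (stabGen (c e)) = 2 ^ e := by
  rw [stabGen_eq_ker e he]
  exact indexTwoRank_ker_lamHom e

end FrobUT

/-- **`G`-agnostic packaging**: for every `e ≠ 0` there is a finite group with a central involution `c ≠ 1` whose type-stabiliser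
subgroup has index `2^{2^e}` and `2`-rank `d₂(G/𝒦(G,c)) = 2^e` — so `G/𝒦` is elementary abelian of rank exactly `d₂`
(the Frobenius‑unitriangular group `𝒰ₑ`). [folklore] -/
theorem exists_indexTwoRank_stabGen_eq_two_pow (e : ℕ) (he : e ≠ 0) :
    ∃ (G : Type) (_ : Group G) (_ : Finite G) (c : G),
      c * c = 1 ∧ c ≠ 1 ∧ (∀ x : G, x * c = c * x) ∧ (stabGen c).index = 2 ^ 2 ^ e ∧
        indexTwoRank (stabGen c) = 2 ^ e :=
  ⟨FrobUT.frobUT e, inferInstance, inferInstance, FrobUT.c e, FrobUT.c_mul_c e, FrobUT.c_ne_one e, FrobUT.c_comm e,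
    FrobUT.index_stabGen e he, FrobUT.indexTwoRank_stabGen_eq_two_pow e he⟩

end

end Summit.HodgeConjecture.CorCM.Census.TypeStabiliser
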